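import Summits.CriticalPhenomena.PercolationContinuityZ3.Theorems.SahiMasterFamilyTrianglePatternsPrelim
import Summits.CriticalPhenomena.PercolationContinuityZ3.Theorems.SahiMasterFamilyMinorClosed

/-!
# The triangle patterns glued over a cored set are never zero flags

Unit `prim-master-conj` (crux anchor stmt-CriticalPhenomena-4575), gen 10; memo HOME/prim-master-conj/TIGHTNESS-II.md §2–§3.

Context.  (EQI-k) for every `k` is reduced (gen 9, `masterFamilyIdentEqIff_all_of_terminalTight`; prim-masterthm-p4,
`masterFamilyIdentEqIff_of_capDichotomy_all`) to the TIGHTNESS / CAP conjecture: a terminal `k`-family has every coordinate in the core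
of some member.  In the "doubly tight" branch of that conjecture (every core-free coordinate `e` has a tight `0`-face, TIGHTNESS-II §2)
with exactly three core-free coordinates `e₁, e₂, e₃` whose "link members" do not all coincide, the structure theory of the faces forces
one of two explicit MEMBERSHIP PATTERNS relative to the cored set `C` (TIGHTNESS-II §2.6):
* pattern (c) ("triangle over `C`"): three members `a₁, a₂, a₃` with `C ∪ {e_t} ∉ U_{a_t}`, `C ∪ {e_s} ∈ U_{a_t}` (`s ≠ t`), and every
  other member containing `C ∪ {e_1}, C ∪ {e_2}, C ∪ {e_3}`;
* pattern (b) ("wedge over `C`"): a member `a₀` with `C ∪ {e₁}, C ∪ {e₂} ∉ U_{a₀} ∋ C ∪ {e₃}, C ∪ {e₁, e₂}`, a member `a₃` with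
  `C ∪ {e₃} ∉ U_{a₃} ∋ C ∪ {e₁}, C ∪ {e₂}`, every other member containing the three configurations `C ∪ {e_t}`.
This file proves, for EVERY order `k` and every `C`, that a family of increasing events determined by `C ∪ {e₁,e₂,e₃}` with pattern (c)
or (b) is NOT a zero flag (`not_suppZeroFlag_of_patC`, `not_suppZeroFlag_of_patB`).  Consequently such a family with `C ≠ ∅` is not
face-vanishing (its `c ← 1` minor, `c ∈ C`, has the same pattern over `C ∖ {c}`: `patC_secAt`, `patB_secAt`), which confines the
triangle exception of the tightness conjecture to `C = ∅`, i.e. to three coordinates (TIGHTNESS-II THEOREM TRI).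
Proof: induction on `|C|` through the `c ← 1` minors (`Z_k` is minor-closed, `suppZeroFlag_secAt_family`); at `C = ∅` the family is,
member by member, the OR-triangle `(x₂∨x₃, x₁∨x₃, x₁∨x₂)` resp. the wedge pair `(x₃ ∨ x₁x₂, x₁∨x₂)` plus absorbers `∈ {x₁∨x₂∨x₃, Ω}`
(`triFam_of_patC_empty`, `wedgeFam_of_patB_empty`), and such families are not zero flags at any order by a direct induction on the
recursive definition of `Z_k` (`not_suppZeroFlag_of_triFam`, `not_suppZeroFlag_of_wedgeFam`): deleting an absorber or shrinking an
absorber against an edge reproduces the family type one order down, and a family of pairwise dependent events has no zero-flag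
certificate (`exists_indepPair_of_suppZeroFlag`).  Pure combinatorics; axioms standard. [this work]
-/

noncomputable section

open scoped Classical

namespace Summit.CriticalPhenomena.PercolationContinuityZ3.Theorems

namespace TrianglePatterns

open Finset Function
open Literature.Probability.LatticeModels.Kahn2022 (Affects)
open Literature.Probability.Percolation (DeterminedBy determinedBy_iff)

variable {ι : Type} [Fintype ι]

/-! ### The patterns over a cored set `C` -/

section Patterns

variable (C : Finset ι) (e₁ e₂ e₃ : ι)

/-- The determining set `C ∪ {e₁, e₂, e₃}`. [this work] -/
def suppSet : Finset ι := insert e₁ (insert e₂ (insert e₃ C))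

/-- The configuration `C ∪ {e}`. [this work] -/
def cfg (e : ι) : Set ι := insert e (↑C : Set ι)

/-- **Pattern (c) over `C`** ("the OR-triangle glued over the cored set `C`"): increasing events determined by `C ∪ {e₁,e₂,e₃}`;
three members `a₁, a₂, a₃` with `C ∪ {e_t} ∉ U_{a_t} ∋ C ∪ {e_s}` (`s ≠ t`); every other member contains `C ∪ {e₁}, C ∪ {e₂}, C ∪ {e₃}`.
[this work] -/
def PatC {k : ℕ} (U : Fin k → Set (Set ι)) : Prop :=
  (∀ j, IsUpperSet (U j)) ∧ (∀ j, DeterminedBy (U j) (↑(suppSet C e₁ e₂ e₃) : Set ι)) ∧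
    ∃ a₁ a₂ a₃ : Fin k,
      (cfg C e₁ ∉ U a₁ ∧ cfg C e₂ ∈ U a₁ ∧ cfg C e₃ ∈ U a₁) ∧
      (cfg C e₂ ∉ U a₂ ∧ cfg C e₁ ∈ U a₂ ∧ cfg C e₃ ∈ U a₂) ∧
      (cfg C e₃ ∉ U a₃ ∧ cfg C e₁ ∈ U a₃ ∧ cfg C e₂ ∈ U a₃) ∧
      ∀ j, j ≠ a₁ → j ≠ a₂ → j ≠ a₃ → cfg C e₁ ∈ U j ∧ cfg C e₂ ∈ U j ∧ cfg C e₃ ∈ U j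

/-- **Pattern (b) over `C`** ("the wedge pair glued over `C`"): increasing events determined by `C ∪ {e₁,e₂,e₃}`; a member `a₀` with
`C ∪ {e₁}, C ∪ {e₂} ∉ U_{a₀} ∋ C ∪ {e₃}, C ∪ {e₁, e₂}`; a member `a₃` with `C ∪ {e₃} ∉ U_{a₃} ∋ C ∪ {e₁}, C ∪ {e₂}`; every other member
contains `C ∪ {e₁}, C ∪ {e₂}, C ∪ {e₃}`. [this work] -/
def PatB {k : ℕ} (U : Fin k → Set (Set ι)) : Prop :=
  (∀ j, IsUpperSet (U j)) ∧ (∀ j, DeterminedBy (U j) (↑(suppSet C e₁ e₂ e₃) : Set ι)) ∧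
    ∃ a₀ a₃ : Fin k,
      (cfg C e₁ ∉ U a₀ ∧ cfg C e₂ ∉ U a₀ ∧ cfg C e₃ ∈ U a₀ ∧ insert e₁ (cfg C e₂) ∈ U a₀) ∧
      (cfg C e₃ ∉ U a₃ ∧ cfg C e₁ ∈ U a₃ ∧ cfg C e₂ ∈ U a₃) ∧
      ∀ j, j ≠ a₀ → j ≠ a₃ → cfg C e₁ ∈ U j ∧ cfg C e₂ ∈ U j ∧ cfg C e₃ ∈ U j

variable {C e₁ e₂ e₃}

omit [Fintype ι] in
/-- Over `C = ∅` the configuration `C ∪ {e}` is the singleton `{e}`. [this work] -/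
theorem cfg_empty (e : ι) : cfg (∅ : Finset ι) e = {e} := by simp [cfg]

omit [Fintype ι] in
/-- Membership in an event determined by `S` is decided by the trace on `S`. [folklore] -/
theorem mem_iff_inter_mem {A : Set (Set ι)} {S : Set ι} (hA : DeterminedBy A S) (ω : Set ι) : ω ∈ A ↔ ω ∩ S ∈ A :=
  (determinedBy_iff A S).1 hA ω (ω ∩ S) (by rw [Set.inter_assoc, Set.inter_self])

omit [Fintype ι] in
/-- At `C = ∅`: an increasing event determined by `{e₁,e₂,e₃}` containing `{e₂}, {e₃}` but not `{e₁}` is the edge `x₂ ∨ x₃`. [this work] -/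
theorem eq_orEv_of_mem {A : Set (Set ι)} (hA : IsUpperSet A) (hdet : DeterminedBy A (↑(suppSet (∅ : Finset ι) e₁ e₂ e₃) : Set ι))
    (h₁ : ({e₁} : Set ι) ∉ A) (h₂ : ({e₂} : Set ι) ∈ A) (h₃ : ({e₃} : Set ι) ∈ A) : A = orEv e₂ e₃ := by
  ext ω
  constructor
  · intro hω
    by_contra hno
    simp only [orEv, Set.mem_setOf_eq, not_or] at hno
    have hsub : ω ∩ (↑(suppSet (∅ : Finset ι) e₁ e₂ e₃) : Set ι) ⊆ {e₁} := by
      intro x ⟨hxω, hxS⟩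
      simp only [suppSet, coe_insert, coe_empty, Set.mem_insert_iff, Set.mem_empty_iff_false,
        or_false] at hxS
      rcases hxS with rfl | rfl | rfl
      · rfl
      · exact absurd hxω hno.1
      · exact absurd hxω hno.2
    exact h₁ (hA hsub ((mem_iff_inter_mem hdet ω).1 hω))
  · rintro (h | h)
    · exact hA (Set.singleton_subset_iff.2 h) h₂
    · exact hA (Set.singleton_subset_iff.2 h) h₃

omit [Fintype ι] in
/-- At `C = ∅`: an increasing event determined by `{e₁,e₂,e₃}` containing `{e₃}, {e₁,e₂}` but neither `{e₁}` nor `{e₂}` is the wedge.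
[this work] -/
theorem eq_wedgeEv_of_mem {A : Set (Set ι)} (hA : IsUpperSet A)
    (hdet : DeterminedBy A (↑(suppSet (∅ : Finset ι) e₁ e₂ e₃) : Set ι))
    (h₁ : ({e₁} : Set ι) ∉ A) (h₂ : ({e₂} : Set ι) ∉ A) (h₃ : ({e₃} : Set ι) ∈ A) (h₁₂ : ({e₁, e₂} : Set ι) ∈ A) :
    A = wedgeEv e₁ e₂ e₃ := by
  ext ω
  constructor
  · intro hω
    by_contra hno
    simp only [wedgeEv, Set.mem_setOf_eq, not_or, not_and] at hno
    have hω' := (mem_iff_inter_mem hdet ω).1 hω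
    by_cases he₁ : e₁ ∈ ω
    · have hsub : ω ∩ (↑(suppSet (∅ : Finset ι) e₁ e₂ e₃) : Set ι) ⊆ {e₁} := by
        intro x ⟨hxω, hxS⟩
        simp only [suppSet, coe_insert, coe_empty, Set.mem_insert_iff, Set.mem_empty_iff_false,
          or_false] at hxS
        rcases hxS with rfl | rfl | rfl
        · rfl
        · exact absurd hxω (hno.2 he₁)
        · exact absurd hxω hno.1
      exact h₁ (hA hsub hω')
    · have hsub : ω ∩ (↑(suppSet (∅ : Finset ι) e₁ e₂ e₃) : Set ι) ⊆ {e₂} := by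
        intro x ⟨hxω, hxS⟩
        simp only [suppSet, coe_insert, coe_empty, Set.mem_insert_iff, Set.mem_empty_iff_false,
          or_false] at hxS
        rcases hxS with rfl | rfl | rfl
        · exact absurd hxω he₁
        · rfl
        · exact absurd hxω hno.1
      exact h₂ (hA hsub hω')
  · rintro (h | ⟨ha, hb⟩)
    · exact hA (Set.singleton_subset_iff.2 h) h₃
    · exact hA (Set.insert_subset_iff.2 ⟨ha, Set.singleton_subset_iff.2 hb⟩) h₁₂

omit [Fintype ι] in
/-- At `C = ∅`: an increasing event determined by `{e₁,e₂,e₃}` containing the three singletons is an absorber. [this work] -/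
theorem isAbsorber_of_mem {A : Set (Set ι)} (hA : IsUpperSet A)
    (hdet : DeterminedBy A (↑(suppSet (∅ : Finset ι) e₁ e₂ e₃) : Set ι))
    (h₁ : ({e₁} : Set ι) ∈ A) (h₂ : ({e₂} : Set ι) ∈ A) (h₃ : ({e₃} : Set ι) ∈ A) : IsAbsorber e₁ e₂ e₃ A := by
  by_cases h0 : (∅ : Set ι) ∈ A
  · exact Or.inr (Set.eq_univ_of_forall fun ω => hA (Set.empty_subset ω) h0)
  · refine Or.inl (Set.ext fun ω => ⟨fun hω => ?_, ?_⟩)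
    · by_contra hno
      simp only [or3Ev, Set.mem_setOf_eq, not_or] at hno
      have hsub : ω ∩ (↑(suppSet (∅ : Finset ι) e₁ e₂ e₃) : Set ι) ⊆ ∅ := by
        intro x ⟨hxω, hxS⟩
        simp only [suppSet, coe_insert, coe_empty, Set.mem_insert_iff, Set.mem_empty_iff_false,
          or_false] at hxS
        rcases hxS with rfl | rfl | rfl
        · exact absurd hxω hno.1
        · exact absurd hxω hno.2.1
        · exact absurd hxω hno.2.2
      exact h0 (Set.subset_empty_iff.1 hsub ▸ (mem_iff_inter_mem hdet ω).1 hω)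
    · rintro (h | h | h)
      · exact hA (Set.singleton_subset_iff.2 h) h₁
      · exact hA (Set.singleton_subset_iff.2 h) h₂
      · exact hA (Set.singleton_subset_iff.2 h) h₃

omit [Fintype ι] in
/-- **Pattern (c) over `C = ∅` is a triangle family.** [this work] -/
theorem triFam_of_patC_empty {k : ℕ} {U : Fin k → Set (Set ι)} (h : PatC (∅ : Finset ι) e₁ e₂ e₃ U) : TriFam e₁ e₂ e₃ U := by
  obtain ⟨hU, hdet, a₁, a₂, a₃, ha₁, ha₂, ha₃, hrest⟩ := h
  simp only [cfg_empty] at ha₁ ha₂ ha₃ hrest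
  have E₁ : U a₁ = orEv e₂ e₃ := eq_orEv_of_mem (hU _) (hdet _) ha₁.1 ha₁.2.1 ha₁.2.2
  have E₂ : U a₂ = orEv e₁ e₃ := by
    refine eq_orEv_of_mem (hU _) ?_ ha₂.1 ha₂.2.1 ha₂.2.2
    have : suppSet (∅ : Finset ι) e₂ e₁ e₃ = suppSet ∅ e₁ e₂ e₃ := Finset.insert_comm _ _ _
    rw [this]; exact hdet _
  have E₃ : U a₃ = orEv e₁ e₂ := by
    refine eq_orEv_of_mem (hU _) ?_ ha₃.1 ha₃.2.1 ha₃.2.2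
    have : suppSet (∅ : Finset ι) e₃ e₁ e₂ = suppSet ∅ e₁ e₂ e₃ := by
      simp only [suppSet]; rw [Finset.insert_comm e₃ e₁, Finset.insert_comm e₃ e₂]
    rw [this]; exact hdet _
  refine ⟨fun j => ?_, ⟨a₁, E₁⟩, ⟨a₂, E₂⟩, ⟨a₃, E₃⟩⟩
  by_cases h₁ : j = a₁
  · subst h₁; exact Or.inl (Or.inl E₁)
  by_cases h₂ : j = a₂
  · subst h₂; exact Or.inl (Or.inr (Or.inl E₂))
  by_cases h₃ : j = a₃
  · subst h₃; exact Or.inl (Or.inr (Or.inr E₃))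
  obtain ⟨m₁, m₂, m₃⟩ := hrest j h₁ h₂ h₃
  exact Or.inr (isAbsorber_of_mem (hU _) (hdet _) m₁ m₂ m₃)

omit [Fintype ι] in
/-- **Pattern (b) over `C = ∅` is a wedge family.** [this work] -/
theorem wedgeFam_of_patB_empty {k : ℕ} {U : Fin k → Set (Set ι)} (h : PatB (∅ : Finset ι) e₁ e₂ e₃ U) : WedgeFam e₁ e₂ e₃ U := by
  obtain ⟨hU, hdet, a₀, a₃, ha₀, ha₃, hrest⟩ := h
  simp only [cfg_empty] at ha₀ ha₃ hrest
  have E₀ : U a₀ = wedgeEv e₁ e₂ e₃ := eq_wedgeEv_of_mem (hU _) (hdet _) ha₀.1 ha₀.2.1 ha₀.2.2.1 ha₀.2.2.2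
  have E₃ : U a₃ = orEv e₁ e₂ := by
    refine eq_orEv_of_mem (hU _) ?_ ha₃.1 ha₃.2.1 ha₃.2.2
    have : suppSet (∅ : Finset ι) e₃ e₁ e₂ = suppSet ∅ e₁ e₂ e₃ := by
      simp only [suppSet]; rw [Finset.insert_comm e₃ e₁, Finset.insert_comm e₃ e₂]
    rw [this]; exact hdet _
  refine ⟨fun j => ?_, ⟨a₀, E₀⟩, ⟨a₃, E₃⟩⟩
  by_cases h₀ : j = a₀
  · subst h₀; exact Or.inl E₀
  by_cases h₃ : j = a₃
  · subst h₃; exact Or.inr (Or.inl E₃)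
  obtain ⟨m₁, m₂, m₃⟩ := hrest j h₀ h₃
  exact Or.inr (Or.inr (isAbsorber_of_mem (hU _) (hdet _) m₁ m₂ m₃))

/-! ### The patterns descend to the `c ← 1` minors, `c ∈ C` -/

omit [Fintype ι] in
/-- Membership of `C' ∪ {e}`-type configurations in a `c ← 1` section (bookkeeping). [this work] -/
theorem cfg_mem_secAt_iff {c : ι} (hc : c ∈ C) (e : ι) (A : Set (Set ι)) :
    cfg (C.erase c) e ∈ secAt c true A ↔ cfg C e ∈ A := by
  rw [mem_secAt]
  simp only [forceAt, cond_true, cfg]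
  rw [Set.insert_comm, coe_erase, Set.insert_sdiff_singleton, Set.insert_eq_of_mem (mem_coe.2 hc)]

omit [Fintype ι] in
/-- Membership of `C' ∪ {e, e'}`-type configurations in a `c ← 1` section (bookkeeping). [this work] -/
theorem insert_cfg_mem_secAt_iff {c : ι} (hc : c ∈ C) (e e' : ι) (A : Set (Set ι)) :
    insert e (cfg (C.erase c) e') ∈ secAt c true A ↔ insert e (cfg C e') ∈ A := by
  rw [mem_secAt]
  simp only [forceAt, cond_true, cfg]
  rw [Set.insert_comm c e, Set.insert_comm c e', coe_erase, Set.insert_sdiff_singleton,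
    Set.insert_eq_of_mem (mem_coe.2 hc)]

omit [Fintype ι] in
/-- Erasing a cored coordinate from the determining set (bookkeeping). [this work] -/
theorem suppSet_erase {c : ι} (h₁ : c ≠ e₁) (h₂ : c ≠ e₂) (h₃ : c ≠ e₃) :
    (suppSet C e₁ e₂ e₃).erase c = suppSet (C.erase c) e₁ e₂ e₃ := by
  simp only [suppSet]
  rw [erase_insert_of_ne h₁.symm, erase_insert_of_ne h₂.symm, erase_insert_of_ne h₃.symm]

omit [Fintype ι] in
/-- **Pattern (c) descends** to the `c ← 1` minor for `c ∈ C`. [this work] -/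
theorem patC_secAt {k : ℕ} {U : Fin k → Set (Set ι)} (h : PatC C e₁ e₂ e₃ U) {c : ι} (hc : c ∈ C)
    (h₁ : c ≠ e₁) (h₂ : c ≠ e₂) (h₃ : c ≠ e₃) : PatC (C.erase c) e₁ e₂ e₃ (fun j => secAt c true (U j)) := by
  obtain ⟨hU, hdet, a₁, a₂, a₃, ha₁, ha₂, ha₃, hrest⟩ := h
  refine ⟨fun j => isUpperSet_secAt c true (hU j), fun j => ?_, a₁, a₂, a₃, ?_, ?_, ?_, fun j hj₁ hj₂ hj₃ => ?_⟩
  · rw [← suppSet_erase h₁ h₂ h₃]; exact determinedBy_secAt c true (hdet j)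
  · simp only [cfg_mem_secAt_iff hc]; exact ha₁
  · simp only [cfg_mem_secAt_iff hc]; exact ha₂
  · simp only [cfg_mem_secAt_iff hc]; exact ha₃
  · simp only [cfg_mem_secAt_iff hc]; exact hrest j hj₁ hj₂ hj₃

omit [Fintype ι] in
/-- **Pattern (b) descends** to the `c ← 1` minor for `c ∈ C`. [this work] -/
theorem patB_secAt {k : ℕ} {U : Fin k → Set (Set ι)} (h : PatB C e₁ e₂ e₃ U) {c : ι} (hc : c ∈ C)
    (h₁ : c ≠ e₁) (h₂ : c ≠ e₂) (h₃ : c ≠ e₃) : PatB (C.erase c) e₁ e₂ e₃ (fun j => secAt c true (U j)) := by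
  obtain ⟨hU, hdet, a₀, a₃, ha₀, ha₃, hrest⟩ := h
  refine ⟨fun j => isUpperSet_secAt c true (hU j), fun j => ?_, a₀, a₃, ?_, ?_, fun j hj₀ hj₃ => ?_⟩
  · rw [← suppSet_erase h₁ h₂ h₃]; exact determinedBy_secAt c true (hdet j)
  · simp only [cfg_mem_secAt_iff hc, insert_cfg_mem_secAt_iff hc]; exact ha₀
  · simp only [cfg_mem_secAt_iff hc]; exact ha₃
  · simp only [cfg_mem_secAt_iff hc]; exact hrest j hj₀ hj₃

/-! ### Main theorems -/

omit [Fintype ι] in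
/-- Patterns need two distinct slots: orders `0, 1` are vacuous (plumbing). [this work] -/
theorem two_le_of_ne {k : ℕ} {a b : Fin k} (h : a ≠ b) : ∃ m, k = m + 2 := by
  rcases k with _ | _ | m
  · exact a.elim0
  · have ha := a.isLt; have hb := b.isLt
    exact absurd (Fin.ext (by omega)) h
  · exact ⟨m, rfl⟩

/-- **THEOREM (pattern (c)).**  For distinct `e₁, e₂, e₃ ∉ C`, a family with pattern (c) over `C` is not a zero flag, at any order.
[this work] -/
theorem not_suppZeroFlag_of_patC (h₁₂ : e₁ ≠ e₂) (h₁₃ : e₁ ≠ e₃) (h₂₃ : e₂ ≠ e₃) :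
    ∀ (C : Finset ι), e₁ ∉ C → e₂ ∉ C → e₃ ∉ C →
      ∀ {k : ℕ} (U : Fin k → Set (Set ι)), PatC C e₁ e₂ e₃ U → ¬ SuppZeroFlag k U := by
  intro C
  induction C using Finset.induction_on with
  | empty =>
    intro _ _ _ k U hP hZ
    obtain ⟨-, -, a₁, a₂, -, ha₁, ha₂, -, -⟩ := id hP
    have hne : a₁ ≠ a₂ := by rintro rfl; exact ha₂.1 ha₁.2.1
    obtain ⟨m, rfl⟩ := two_le_of_ne hne
    exact not_suppZeroFlag_of_triFam h₁₂ h₁₃ h₂₃ m U (triFam_of_patC_empty hP) hZ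
  | insert c C hcC ih =>
    intro he₁ he₂ he₃ k U hP hZ
    simp only [mem_insert, not_or] at he₁ he₂ he₃
    have hP' := patC_secAt hP (mem_insert_self c C) (Ne.symm he₁.1) (Ne.symm he₂.1) (Ne.symm he₃.1)
    rw [erase_insert hcC] at hP'
    exact ih he₁.2 he₂.2 he₃.2 _ hP' (suppZeroFlag_secAt_family c true k U hZ)

/-- **THEOREM (pattern (b)).**  For distinct `e₁, e₂, e₃ ∉ C`, a family with pattern (b) over `C` is not a zero flag, at any order.
[this work] -/
theorem not_suppZeroFlag_of_patB (h₁₂ : e₁ ≠ e₂) (h₁₃ : e₁ ≠ e₃) (h₂₃ : e₂ ≠ e₃) :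
    ∀ (C : Finset ι), e₁ ∉ C → e₂ ∉ C → e₃ ∉ C →
      ∀ {k : ℕ} (U : Fin k → Set (Set ι)), PatB C e₁ e₂ e₃ U → ¬ SuppZeroFlag k U := by
  intro C
  induction C using Finset.induction_on with
  | empty =>
    intro _ _ _ k U hP hZ
    obtain ⟨-, -, a₀, a₃, ha₀, ha₃, -⟩ := id hP
    have hne : a₀ ≠ a₃ := by rintro rfl; exact ha₀.1 ha₃.2.1
    obtain ⟨m, rfl⟩ := two_le_of_ne hne
    exact not_suppZeroFlag_of_wedgeFam h₁₂ h₁₃ h₂₃ m U (wedgeFam_of_patB_empty hP) hZ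
  | insert c C hcC ih =>
    intro he₁ he₂ he₃ k U hP hZ
    simp only [mem_insert, not_or] at he₁ he₂ he₃
    have hP' := patB_secAt hP (mem_insert_self c C) (Ne.symm he₁.1) (Ne.symm he₂.1) (Ne.symm he₃.1)
    rw [erase_insert hcC] at hP'
    exact ih he₁.2 he₂.2 he₃.2 _ hP' (suppZeroFlag_secAt_family c true k U hZ)

/-- **COROLLARY (the triangle patterns are not face-vanishing off three coordinates).**  If `U` has pattern (c) over a NON-EMPTY cored
set `C`, then some single-coordinate minor of `U` is not a zero flag (namely `U^{c ← 1}`, `c ∈ C`); likewise for pattern (b).  This is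
the form used by the tightness programme: a face-vanishing family cannot carry pattern (c)/(b) unless `C = ∅`. [this work] -/
theorem exists_minor_not_suppZeroFlag_of_patC (h₁₂ : e₁ ≠ e₂) (h₁₃ : e₁ ≠ e₃) (h₂₃ : e₂ ≠ e₃) (he₁ : e₁ ∉ C) (he₂ : e₂ ∉ C)
    (he₃ : e₃ ∉ C) (hC : C.Nonempty) {k : ℕ} (U : Fin k → Set (Set ι)) (hP : PatC C e₁ e₂ e₃ U) :
    ∃ c ∈ C, ¬ SuppZeroFlag k (fun j => secAt c true (U j)) := by
  obtain ⟨c, hc⟩ := hC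
  refine ⟨c, hc, not_suppZeroFlag_of_patC h₁₂ h₁₃ h₂₃ (C.erase c) ?_ ?_ ?_ _ (patC_secAt hP hc ?_ ?_ ?_)⟩
  all_goals first
    | exact fun h => he₁ (mem_of_mem_erase h)
    | exact fun h => he₂ (mem_of_mem_erase h)
    | exact fun h => he₃ (mem_of_mem_erase h)
    | (rintro rfl; exact he₁ hc)
    | (rintro rfl; exact he₂ hc)
    | (rintro rfl; exact he₃ hc)

/-- Pattern (b) over a non-empty cored set has a single-coordinate minor that is not a zero flag. [this work] -/
theorem exists_minor_not_suppZeroFlag_of_patB (h₁₂ : e₁ ≠ e₂) (h₁₃ : e₁ ≠ e₃) (h₂₃ : e₂ ≠ e₃) (he₁ : e₁ ∉ C) (he₂ : e₂ ∉ C)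
    (he₃ : e₃ ∉ C) (hC : C.Nonempty) {k : ℕ} (U : Fin k → Set (Set ι)) (hP : PatB C e₁ e₂ e₃ U) :
    ∃ c ∈ C, ¬ SuppZeroFlag k (fun j => secAt c true (U j)) := by
  obtain ⟨c, hc⟩ := hC
  refine ⟨c, hc, not_suppZeroFlag_of_patB h₁₂ h₁₃ h₂₃ (C.erase c) ?_ ?_ ?_ _ (patB_secAt hP hc ?_ ?_ ?_)⟩
  all_goals first
    | exact fun h => he₁ (mem_of_mem_erase h)
    | exact fun h => he₂ (mem_of_mem_erase h)
    | exact fun h => he₃ (mem_of_mem_erase h)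
    | (rintro rfl; exact he₁ hc)
    | (rintro rfl; exact he₂ hc)
    | (rintro rfl; exact he₃ hc)

end Patterns

end TrianglePatterns

end Summit.CriticalPhenomena.PercolationContinuityZ3.Theorems
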